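import Mathlib
import HarnessLib
import Summits.Ventures.LatticeQCDFlow.Exactness.CabibboMarinari

/-!
# The unit part of a quaternion and its equivariance (algebra for the Cabibbo–Marinari over-relaxation hit)

HONEST FRAMING: exact (Metropolis-corrected) sampling algorithms for lattice gauge theory;
figures of merit are autocorrelation/cost numbers at stated couplings and volumes; no
continuum-physics claim.

Venture `LatticeQCDFlow` (cell pub-lqcd), topic `Exactness`, FANOUT row 9 (eng-latcore).  NEW WORK of
the cell: `2 × 2` quaternion algebra over `SU2StapleSum.lean` (`IsQuat`, `normSq`, polar form) and
`CabibboMarinari.lean` (`quatDouble`); nothing is cited as a fact.  Used by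
`CabibboMarinariOverrelax.lean` (the engine's `N ≥ 3` over-relaxation hit `g ↦ φ((ŝ†)²) g`).

## Content

* `IsQuat.eq_zero_of_normSq`, `IsQuat.normSq_eq_one_of_mem`, `IsQuat.normSq_mul_of_mem`
  (`|A Q|² = |Q|²` for `A ∈ SU(2)`).
* `quatUnit Q` — the unit part `ŝ` with `Q = √|Q|² • ŝ` (`ŝ = 1` if `Q = 0`): `quatUnit_mem`
  (`ŝ ∈ SU(2)`), `quatUnit_smul` (polar form), `quatUnit_quat_mul` (`ŝ(A Q) = A ŝ(Q)` off `Q = 0`),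
  `quatUnit_quat_mul_of_eq_zero`.
* `quatDouble_quat_mul` — the quaternionic projection commutes with left multiplication by a
  quaternion: `quatDouble (A w) = A · quatDouble w`.
-/

namespace Summit.Ventures.LatticeQCDFlow.Exactness

open Matrix ComplexConjugate

/-! ## §1 Quaternion algebra: unit part, left multiplication -/

section Quat

variable {A Q : Matrix (Fin 2) (Fin 2) ℂ}

/-- A quaternion with vanishing squared norm is zero. -/
theorem IsQuat.eq_zero_of_normSq (hQ : IsQuat Q) (h : IsQuat.normSq Q = 0) : Q = 0 := by
  by_contra h0
  exact (hQ.normSq_pos h0).ne' h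

/-- The squared norm of an SU(2) matrix is one. -/
theorem IsQuat.normSq_eq_one_of_mem (hA : A ∈ Matrix.specialUnitaryGroup (Fin 2) ℂ) :
    IsQuat.normSq A = 1 := by
  have h := (IsQuat.of_mem_specialUnitaryGroup hA).det_eq
  rw [(Matrix.mem_specialUnitaryGroup_iff.mp hA).2] at h
  exact_mod_cast h.symm

/-- The squared norm is multiplicative against unit quaternions: `|A Q|² = |Q|²` for `A ∈ SU(2)`. -/
theorem IsQuat.normSq_mul_of_mem (hA : A ∈ Matrix.specialUnitaryGroup (Fin 2) ℂ) (hQ : IsQuat Q) :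
    IsQuat.normSq (A * Q) = IsQuat.normSq Q := by
  have hAq := IsQuat.of_mem_specialUnitaryGroup hA
  have h := (hAq.mul hQ).det_eq
  rw [Matrix.det_mul, (Matrix.mem_specialUnitaryGroup_iff.mp hA).2, one_mul, hQ.det_eq] at h
  exact_mod_cast h.symm

/-- The unit part `ŝ` of a quaternion `Q = √|Q|² ŝ` (`ŝ = 1` when `Q = 0`). -/
noncomputable def quatUnit (Q : Matrix (Fin 2) (Fin 2) ℂ) : Matrix (Fin 2) (Fin 2) ℂ :=
  if IsQuat.normSq Q = 0 then 1 else (((Real.sqrt (IsQuat.normSq Q))⁻¹ : ℝ) : ℂ) • Q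

/-- The unit part of a quaternion lies in SU(2). -/
theorem quatUnit_mem (hQ : IsQuat Q) : quatUnit Q ∈ Matrix.specialUnitaryGroup (Fin 2) ℂ := by
  unfold quatUnit
  split_ifs with h
  · exact Submonoid.one_mem _
  · have hq : 0 < IsQuat.normSq Q := lt_of_le_of_ne (IsQuat.normSq_nonneg Q) (Ne.symm h)
    set k : ℝ := Real.sqrt (IsQuat.normSq Q) with hk
    have hk0 : 0 < k := Real.sqrt_pos.mpr hq
    have hkk : (k : ℂ) * k = (IsQuat.normSq Q : ℝ) := by
      rw [← Complex.ofReal_mul, Real.mul_self_sqrt hq.le]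
    have hkne : (k : ℂ) ≠ 0 := Complex.ofReal_ne_zero.mpr hk0.ne'
    rw [Complex.ofReal_inv, Matrix.mem_specialUnitaryGroup_iff, Matrix.mem_unitaryGroup_iff,
      Matrix.star_eq_conjTranspose]
    constructor
    · rw [conjTranspose_smul, Matrix.smul_mul, Matrix.mul_smul, hQ.mul_conjTranspose_self, smul_smul,
        smul_smul, Complex.star_def, Complex.conj_inv, Complex.conj_ofReal, ← hkk]
      convert one_smul ℂ (1 : Matrix (Fin 2) (Fin 2) ℂ) using 2
      field_simp
    · rw [Matrix.det_smul, hQ.det_eq, Fintype.card_fin, ← hkk]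
      field_simp

/-- Polar form: `√|Q|² • ŝ = Q`. -/
theorem quatUnit_smul (hQ : IsQuat Q) :
    ((Real.sqrt (IsQuat.normSq Q) : ℝ) : ℂ) • quatUnit Q = Q := by
  unfold quatUnit
  split_ifs with h
  · rw [h, Real.sqrt_zero, Complex.ofReal_zero, zero_smul]
    exact (hQ.eq_zero_of_normSq h).symm
  · have hq : 0 < IsQuat.normSq Q := lt_of_le_of_ne (IsQuat.normSq_nonneg Q) (Ne.symm h)
    have hkne : ((Real.sqrt (IsQuat.normSq Q) : ℝ) : ℂ) ≠ 0 :=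
      Complex.ofReal_ne_zero.mpr (Real.sqrt_pos.mpr hq).ne'
    rw [smul_smul, Complex.ofReal_inv, mul_inv_cancel₀ hkne, one_smul]

/-- The unit part commutes with left multiplication by a unit quaternion (away from `Q = 0`). -/
theorem quatUnit_quat_mul (hA : A ∈ Matrix.specialUnitaryGroup (Fin 2) ℂ) (hQ : IsQuat Q)
    (h0 : IsQuat.normSq Q ≠ 0) : quatUnit (A * Q) = A * quatUnit Q := by
  unfold quatUnit
  rw [IsQuat.normSq_mul_of_mem hA hQ, if_neg h0, if_neg h0, Matrix.mul_smul]

/-- On the null quaternion the unit part of `A Q` is `1`. -/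
theorem quatUnit_quat_mul_of_eq_zero (hA : A ∈ Matrix.specialUnitaryGroup (Fin 2) ℂ) (hQ : IsQuat Q)
    (h0 : IsQuat.normSq Q = 0) : quatUnit (A * Q) = 1 := by
  unfold quatUnit
  rw [IsQuat.normSq_mul_of_mem hA hQ, if_pos h0]

/-- The quaternionic projection commutes with left multiplication by a quaternion:
`quatDouble (A w) = A · quatDouble w`. -/
theorem quatDouble_quat_mul (hA : IsQuat A) (w : Matrix (Fin 2) (Fin 2) ℂ) :
    quatDouble (A * w) = A * quatDouble w := by
  ext i j
  fin_cases i <;> fin_cases j <;>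
    simp [quatDouble, quatOf, Matrix.mul_apply, Fin.sum_univ_two, hA.diag, hA.offdiag, map_add,
      map_sub, map_mul, map_neg] <;> ring

end Quat

end Summit.Ventures.LatticeQCDFlow.Exactness
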